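import Literature.Geometry.Lorentzian.KerrSchild
import Literature.Geometry.Lorentzian.Einstein
import HarnessLib

/-!
# Barrier catalogue `FinalStateConjecture`: Killing fields need not extend across a smooth (non-analytic) Kerr horizon — the Ionescu–Klainerman counterexample to local rigidity
(`Literature/Barriers/FinalStateConjecture/`, D-0021; family `gr`, summit `FinalStateConjecture`;
namespace `Literature.Barriers.FinalStateConjecture`)

The identification of the final state in the final state conjecture as *Kerr* passes, in every
stationary-limit strategy, through black hole uniqueness ("no hair"), whose classical proof
(Hawking rigidity + Carter–Robinson) constructs the axial Killing field from real-analyticity;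
the prelude records the modern uniqueness theorem only as a schema in its analyticity /
`I⁺`-regularity hypotheses (`Literature.Geometry.Lorentzian.stationary_black_hole_uniqueness`, `BlackHoles.lean`,
gr.S23) and the near-Kerr smooth rigidity theorem of Alexakis–Ionescu–Klainerman likewise.
This file vendors, as a **named fact** (D-0014), the local counterexample of Ionescu–Klainerman
showing that without analyticity the additional symmetry cannot be produced from local
information at the horizon: near any point of the event horizon of Kerr `K(m, a)`,
`0 < a < m`, off the bifurcation sphere, there are smooth stationary Ricci-flat modifications
of the Kerr metric on the exterior side which agree with Kerr inside the black hole and to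
which the axial Killing field `Z = ∂_φ` does not extend as a Killing field commuting with `T`
(J. Amer. Math. Soc. 26 (2013) 563–593, Thm. 1.3, stated there at the past horizon `𝓗⁻`
with fn. 3: "A similar statement can be made on the future event horizon `𝓗⁺`").

* `IonescuKlainermanNonExtension` — **the barrier declaration** (structured block in its
  docstring).

## Rendering on the prelude (`KerrSchild.lean`)

* *Where.* The ingoing Kerr–Schild chart `E4 ⊇ Kerr.region a r₀` covers the exterior, the
  future event horizon `𝓗⁺ = {r = r₊}` (`Kerr.futureEventHorizon M a`, automatically off the
  bifurcation sphere, which the ingoing chart does not contain) and the black hole region; the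
  printed `𝓗⁻`-statement is transported to `𝓗⁺` by the discrete isometry `(t, φ) ↦ (−t, −φ)`
  of Kerr, as licensed by fn. 3, so that "`g̃ = g` in `U ∖ E`" becomes agreement with the Kerr–
  Schild form `Kerr.bilin M a` on `U ∩ {r ≤ r₊}` ("coincide with `K(m, a)` inside the black hole",
  p. 3 of the arXiv version).
* *What.* `U` is an open subset of `E4` inside the prescribed open `U₀ ∋ p`, meeting `𝓗⁺`
  (the printed "diffeomorphic to the unit ball" is dropped — an existential weakening); `g̃` is a
  `C^∞` Lorentzian metric on `U` (`LorentzianMetric 𝓘(ℝ, E4) ∞ U`); Ricci-flatness and the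
  Killing property are the prelude's `PseudoRiemannianMetric.IsRicciFlat` / `IsKillingField`
  under the standing Levi-Civita hypothesis `[g̃.HasLeviCivita]`, bound inside exactly as in
  `Kerr.isRicciFlat`, `Kerr.isKillingField_stationaryField`; `T = ∂_{t*}` is the constant
  field `E4.basisVector 0` (`Kerr.stationaryField`; `∂_t = ∂_{t*}`), `Z = ∂_φ = x¹∂₂ − x²∂₁`
  (`Kerr.axialField`; `∂_φ = ∂_{φ*}` in Kerr–Schild Cartesian coordinates
  `x + iy = (r + ia) sin θ e^{iφ*}`); "commuting with `T`" is `[T, Z̃] = ∂_{t*} Z̃ = 0`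
  componentwise (`T` has constant components), rendered with `mfderiv` of the component map.
  Requiring the would-be extension `Z̃` to be a (smooth) Killing field agreeing with `Z` on
  `U ∩ {r ≤ r₊}` makes the non-existence clause weaker than any reading of "does not extend".

## Barrier audit (D-0021, 2026-08-15): the obstruction is purely local — scope of `blocks:` narrowed

The vendored `Prop` is a faithful (existentially weakened) rendering of the printed theorem and
stands. What the audit narrows is the reach recorded in the structured block. The printed
argument quantifies only over inferences drawn from the data `(g̃, T, Ric = 0)` on an
*arbitrarily small* neighbourhood of *one* horizon point off the bifurcation sphere, in the region
where `T` is spacelike (the construction is a characteristic initial-value problem for the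
`T`-reduced equations, whose quotient metric `h = X g − T ⊗ T`, `X = g(T, T)`, is Lorentzian only
where `X > 0`; hence `a > 0`, and the Schwarzschild case is open — §1, p. 3 and §3 of the paper;
`IonescuKlainermanNonExtension.small_ball` records the localisation formally). Inside the same
technique class (extension of Killing fields / unique continuation in *smooth* vacuum, no
analyticity) the opposite conclusion is a theorem as soon as a whole horizon or a bifurcation
sphere is available:

* interior side: a smooth stationary (electro)vacuum black hole with past-incomplete horizon
  generators carries a Killing field normal to the horizon on the interior one-sided
  neighbourhood `J⁺[𝓝] ∩ 𝓥` (Friedrich–Rácz–Wald 1999, Cor. 4.1);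
* bifurcate horizons: a local, regular, bifurcate, non-expanding horizon `(S, 𝓝, 𝓝̲)` in a smooth
  vacuum spacetime is a Killing bifurcate horizon on a *full* neighbourhood of `S`, and if a
  Killing field `T` is tangent to `𝓝 ∪ 𝓝̲` and non-vanishing on `S` there is a rotational Killing
  field commuting with `T` near `S` (Alexakis–Ionescu–Klainerman, GAFA 2010, Thms. 1.1–1.2 — "an
  unconditional local rigidity result", in the words of AIK 2014, §1; Ionescu–Klainerman 2013,
  fn. 4: "The key additional information used in that paper is the existence of a regular
  bifurcation sphere");
* future horizon alone: for a smooth stationary asymptotically flat vacuum black hole with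
  `M = I⁺(M_ext)` (no white hole, no bifurcation surface) whose event horizon has surface gravity
  normalisable to a non-zero constant, `𝓗_bh` is a smooth Killing horizon — a Killing field on an
  open, stationary-flow-invariant neighbourhood of the *whole* horizon, both sides — by a
  "non-local" unique continuation theorem for waves through *compact* null hypersurfaces of
  constant non-zero surface gravity, applied on the Friedrich–Rácz–Wald quotient (Petersen 2021,
  Thms. 1.4, 1.9, 1.17; one-sided version Petersen–Rácz 2023, Thm. 1.2); it fails for vanishing
  surface gravity (ibid., Example 1.11).

The counterexample metric of Thm. 1.3 lives on `𝒟 × I` in coordinates adapted to a hypersurface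
transversal to `T`; its `T`-saturation is a strip along one `T`-orbit family and is neither a
neighbourhood of the bifurcation sphere nor a `T`-invariant neighbourhood of the horizon, so
there is no conflict — and, conversely, the local modification cannot be continued to such
neighbourhoods. For the no-hair step of a stationary-limit route this means: with a
non-degenerate limiting horizon the Hawking field and near-horizon axisymmetry are available in
the smooth class; what remains open (and is *not* what this barrier formalises) is the
continuation of the axial field from the horizon neighbourhood across the ergoregion, where `T`
is spacelike and the metric need not be analytic, into the region where `T` is timelike (there
stationary vacuum metrics are analytic, Müller zum Hagen 1970, and `T`-conditional
pseudo-convexity is automatic, AIK 2014, §1) — achieved so far only for Mars–Simon-small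
perturbations of Kerr (AIK, CMP 2010), for small `‖g(T,T)‖_{L^∞(S₀)}` (AIK 2014, Thm. 1.1), or
under a scalar identity on `S₀` (Ionescu–Klainerman 2009, Main Theorem). The obstruction the
authors themselves single out for that global step is a different one — null geodesics trapped
and perpendicular to a Killing field `T + cZ`, whence "a full proof of the rigidity conjecture
must rely on global properties of the space-time" and their conjecture that absence of trapped
null geodesics perpendicular to `T` implies Kerr (Ionescu–Klainerman 2015 review, §2.3,
Remark 2.23, §4); it is recorded in `scope_caveats` (g) and is not formalised in this file.

## References

* A. D. Ionescu, S. Klainerman, *On the local extension of Killing vector-fields in Ricci flat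
  manifolds*, J. Amer. Math. Soc. 26 (2013) 563–593 (arXiv:1108.3575), §1 (pp. 2–4),
  Thm. 1.2, Thm. 1.3 with fnn. 3–4, §3, Thm. 4.1, Thm. 4.3.
* S. Alexakis, A. D. Ionescu, S. Klainerman, *Uniqueness of smooth stationary black holes in
  vacuum: small perturbations of the Kerr spaces*, Comm. Math. Phys. 299 (2010) 89–127.
* S. Alexakis, A. D. Ionescu, S. Klainerman, *Hawking's local rigidity theorem without
  analyticity*, Geom. Funct. Anal. 20 (2010) 845–869 (arXiv:0902.1173), Thms. 1.1–1.2.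
* S. Alexakis, A. D. Ionescu, S. Klainerman, *Rigidity of stationary black holes with small
  angular momentum on the horizon*, Duke Math. J. 163 (2014) 2603–2615 (arXiv:1304.0487), §1,
  Thm. 1.1, Prop. 1.3.
* A. D. Ionescu, S. Klainerman, *On the uniqueness of smooth, stationary black holes in vacuum*,
  Invent. Math. 175 (2009) 35–102 (arXiv:0711.0040), Main Theorem.
* H. Friedrich, I. Rácz, R. M. Wald, *On the rigidity theorem for spacetimes with a stationary
  event horizon or a compact Cauchy horizon*, Comm. Math. Phys. 204 (1999) 691–707, Cor. 4.1.
* O. L. Petersen, *Extension of Killing vector fields beyond compact Cauchy horizons*, Adv. Math.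
  391 (2021) 107953 (arXiv:1903.09135), Thms. 1.4, 1.6, 1.9, 1.17, Ex. 1.11; O. Petersen,
  I. Rácz, Ann. Henri Poincaré 24 (2023) 3921–3943 (arXiv:1809.02580), Thm. 1.2.
* S. Alexakis, V. Schlue, *Non-existence of time-periodic vacuum space-times*, J. Differential
  Geom. 108 (2018) 1–62 (arXiv:1504.04592), Thm. 1.2, Prop. 4.5.
* H. Müller zum Hagen, *On the analyticity of stationary vacuum solutions of Einstein's
  equation*, Proc. Cambridge Philos. Soc. 68 (1970) 199–201.
* P. T. Chruściel, J. L. Costa, *On uniqueness of stationary vacuum black holes*, Astérisque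
  321 (2008) 195–265, Thm. 1.3, §8.
* A. D. Ionescu, S. Klainerman, *Rigidity results in general relativity: a review*, Surv.
  Differ. Geom. 20 (2015) 123–156 (arXiv:1501.01587), §1, §2.3 (Thm. 2.22, Remark 2.23), §4.
* S. Klainerman, C. R. Mécanique 353 (2025), §2.5 (1) and ref. [9].
-/

noncomputable section

open Set TopologicalSpace
open scoped Manifold ContDiff

namespace Literature.Barriers.FinalStateConjecture

open Literature.Geometry.Lorentzian

/-- **Barrier (Ionescu–Klainerman): across a smooth Kerr horizon, `0 < a < m`, the axial
Killing field need not extend — stationary Ricci-flat local modifications of Kerr without a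
second Killing field exist near any horizon point off the bifurcation sphere, so Hawking-type
rigidity cannot be obtained from local information at such a point alone (purely local: on a
neighbourhood of a bifurcation sphere, or on a stationary neighbourhood of a whole horizon of
constant non-zero surface gravity, the Hawking and axial Killing fields DO extend without
analyticity — audit 2026-08-15, module docstring).** J. Amer. Math. Soc. 26 (2013), Thm. 1.3: "Assume that `0 < a < m` and `U₀ ⊆ K(m, a)`
is an open set such that `U₀ ∩ 𝓗⁻ ∩ Ē ≠ ∅`. Then there is an open set `U ⊆ U₀` diffeomorphic to
the open unit ball `B₁ ⊆ ℝ⁴`, `U ∩ 𝓗⁻ ≠ ∅`, and a smooth Lorentz metric `g̃` in `U` with the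
following properties: (i) `Ric(g̃) = 0` in `U`, `𝓛_T g̃ = 0` in `U`, `g̃ = g` in `U ∖ E`; (ii) the
vector-field `Z = d/dφ` does not extend to a Killing vector-field for `g̃`, commuting with `T`,
in `U`." Fn. 3: "A similar statement can be made on the future event horizon `𝓗⁺`." Ibid.,
p. 4: "unlike in the analytic situation, one cannot hope to construct an additional symmetry
of stationary solutions of the Einstein-vacuum equations (as in Hawking's Rigidity Theorem) by
relying only on the local information provided by the equations."

**Vendored form** (`𝓗⁺` version on the ingoing Kerr–Schild chart, existentially weakened;
module docstring): for `0 < a < M`, every horizon point `p ∈ {r = r₊}` and every open `U₀ ∋ p`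
of `E4` there are an open `U ⊆ U₀` meeting `{r = r₊}` and a `C^∞` Lorentzian metric `g̃` on `U`
which equals the Kerr–Schild form `g_{M,a}` on `U ∩ {r ≤ r₊}`, is Ricci-flat, has `∂_{t*}` as
a Killing field, and admits **no** Killing field `Z̃` with `∂_{t*} Z̃ = 0` that equals
`∂_φ = x¹∂₂ − x²∂₁` on `U ∩ {r ≤ r₊}` (Levi-Civita-dependent clauses under the standing
hypothesis `[g̃.HasLeviCivita]`, bound inside).

BARRIER (D-0021; every clause is a quotation or close paraphrase of the cited locus):
* technique_class: black-hole-uniqueness, no-hair, rigidity, Hawking-rigidity, Killing-extension, unique-continuation, stationary-limit, non-analytic, local-methods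
* blocks: ONLY the purely local step — inferring a second (Hawking / axial) Killing field of a smooth stationary vacuum metric from the data `(g̃, T, Ric = 0)` on an arbitrarily small neighbourhood of a single horizon point off the bifurcation sphere, i.e. unique continuation of the axial Killing field across a smooth non-bifurcate piece of the horizon from local information on one side: "at any point `p` in the complement of the bifurcation sphere of the horizon of a Kerr spacetime [...] one can find local extensions of the Kerr metric, which coincide with `K(m, a)` inside the black hole, and such that only `T` extends as a Killing vector-field to a full neighborhood of `p`"; "one cannot hope to construct an additional symmetry of stationary solutions of the Einstein-vacuum equations (as in Hawking's Rigidity Theorem) by relying only on the local information provided by the equations" [cite: IonescuKlainerman2012, §1 (p. 3), Thm. 1.3 and p. 4]; and, in the same local sense (no stationarity kept), extension of a Killing field tangent to a transversal null foliation across a null hypersurface of a 4-dimensional vacuum spacetime [cite: IonescuKlainerman2012, Thm. 4.3]. It bears on the no-hair step of a stationary-limit route (`Literature.Geometry.Lorentzian.Development.SettlesToKerrFamily`; schema `Literature.Geometry.Lorentzian.stationary_black_hole_uniqueness`, whose printed instance assumes analyticity [cite: ChruscielCosta2008, Thm. 1.3]) only if that step would build the axial Killing field by such a purely local argument; constructions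 that use a bifurcation sphere, a stationary neighbourhood of the whole non-degenerate horizon, the interior domain of dependence, null infinity, or the global structure of the domain of outer communications are NOT covered (`evasions_known`).
* because: Nomizu's analytic continuation of Killing fields, used "to reduce the black hole rigidity problem, for real analytic stationary solutions [...] to the simpler case of axial symmetry treated by the Carter–Robinson theorem", has no smooth counterpart: "All these are clearly wrong in the case of smooth manifolds which are not real analytic [...] Local and global assumptions also need to be carefully separated" [cite: IonescuKlainerman2012, §1 (p. 2)]; a null hypersurface is not strongly pseudo-convex, so the local Carleman extension theorem (Thm. 1.2) does not apply across it [cite: IonescuKlainerman2012, discussion before Thm. 1.2 (pp. 2–3)]; the counterexample is a characteristic initial-value problem (Rendall) for the `T`-reduced system — quotient metric `h = X g − T ⊗ T`, `X = g(T, T)`, "nondegenerate (Lorentzian) as long as `X > 0` in `Π`, which explains our assumption `0 < a < m`" — posed off the horizon image `𝓝₀` and a transversal null hypersurface `𝓝₁` of the 3-dimensional quotient near one point, with free data `Ỹ = Y + εψ((y − y(p′))/ε)` on `𝓝₁ ∩ {Δ > 0}` and the space-time metric rebuilt on `𝒟 × I` [cite: IonescuKlainerman2012, §3 (plan of proof,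 Props. 3.3–3.6, proof of Thm. 1.3)]; hence "The condition `a > 0` is important in our proof" and the Schwarzschild case "remains open" [cite: IonescuKlainerman2012, §1 (p. 3)] — in the authors' later words, "the construction of the extended metric [...] relies in an essential way on the fact that `a ≠ 0` to allow for a non-trivial ergo-region near the horizon where `T` is space-like. No such result is known for `a = 0`" [cite: IonescuKlainerman2015, Remark 2.23].
* evasions_known: (1) real-analyticity (Hawking–Nomizu–Carter–Robinson; the modern theorem [cite: ChruscielCosta2008, Thm. 1.3]); (2) a bifurcation sphere, LOCALLY and UNCONDITIONALLY, no analyticity, no smallness: "Given a local, regular, bifurcate, non-expanding horizon `(S, 𝓝, 𝓝̲)` in a smooth, vacuum Einstein space-time [...] there exists an open neighborhood `O′` of `S` and a non-trivial Killing vector-field `K` in `O′`", and with a Killing field `T` tangent to `𝓝 ∪ 𝓝̲`, non-vanishing on `S`, "a non-trivial rotational Killing vector-field `Z` in `O′` which commutes with `T`" [cite: AlexakisIonescuKlainerman2010, Thms. 1.1–1.2] — "The key additional information used in that paper is the existence of a regular bifurcation sphere" [cite: IonescuKlainerman2012, fn. 4], "An unconditional local rigidity result" [cite: AlexakisIonescuKlainerman2014,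 §1]; (3) the interior side: for a smooth stationary electrovac black hole whose horizon generators are past incomplete "in `J⁺[𝓝] ∩ 𝓥` there exists a smooth Killing vector field `kᵃ` which is normal to `𝓝`" [cite: FriedrichRaczWald1999, Cor. 4.1]; (4) the whole future horizon without a bifurcation surface: for a smooth stationary asymptotically flat vacuum black hole with `M = I⁺(M_ext)` whose event horizon has surface gravity normalisable to a non-zero constant, "`𝓗_bh` is a smooth Killing horizon [...] a Killing vector field `W`, defined on an open neighbourhood `U` of `𝓗_bh`", `U` invariant under the stationary flow, via unique continuation for waves through compact null hypersurfaces of constant non-zero surface gravity ("our proof does not rely on the existence of a bifurcation surface. We extend the Killing vector field from either the future or the past event horizon") [cite: Lindbladpetersen2021, Thms. 1.4, 1.9, 1.17]; one-sided (globally hyperbolic side) version [cite: PetersenRacz2023, Thm. 1.2]; (5) global smooth uniqueness of Kerr, given the near-horizon symmetry of (2): under Mars–Simon smallness (prelude schema `Literature.Geometry.Lorentzian.AlexakisIonescuKlainermanRigidity`) [cite: AlexakisIonescuKlainerman2009]; under `‖g(T,T)‖_{L^∞(S₀)} < ε²` alone ("small angular momentum on the horizon [...] No other global restrictions are necessary"),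 the ergoregion then lying inside the domain of extension of `Z` [cite: AlexakisIonescuKlainerman2014, Thm. 1.1 and Prop. 1.3]; under the identity `−4M²F² = (1 − σ)⁴` on `S₀`, for all `0 < a < M` [cite: IonescuKlainerman2008, Main Theorem]; (6) where `T` is timelike: stationary vacuum metrics are real-analytic there [cite: MullerZumHagen1970] ("using standard elliptic theory [...] but there is no reason to expect the same result to hold true in the ergo-region" [cite: IonescuKlainerman2015, §1]), and "`T`-conditional pseudo-convexity is automatically satisfied" [cite: AlexakisIonescuKlainerman2014, §1]; extension across strongly pseudo-convex hypersurfaces in Ricci-flat manifolds of any signature [cite: IonescuKlainerman2012, Thm. 1.2] and, across a null hypersurface, whenever `(𝓛_Z R)(L, X, L, Y) = 0` along the transversal null hypersurface [cite: IonescuKlainerman2012, Thm. 4.1]; (7) from infinity: Killing fields satisfying the Killing equation to all orders at null infinity of a positive-mass asymptotically flat spacetime are genuine Killing fields near infinity (time-periodic vacuum spacetimes are stationary near `𝓘±`) [cite: AlexakisSchlue2018, Thm. 1.2 and Prop. 4.5]; (8) in the dynamical setting the final Kerr parameters are identified by the stability mechanism itself (GCM modulation) for data close to slowly rotating Kerr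 [cite: Klainerman2025, §2.5 (1) and §4]. No smooth large-deviation uniqueness theorem is recorded in these sources: the open part is the continuation of `Z` from the horizon neighbourhood across the ergoregion (module docstring).
* scope_caveats: (a) a LOCAL statement near one horizon point for `0 < a < M`: it does not produce a global stationary asymptotically flat non-Kerr black hole, so global smooth uniqueness (with its global hypotheses) is neither refuted nor addressed — "Local and global assumptions also need to be carefully separated" [cite: IonescuKlainerman2012, §1 (p. 2)]; the Schwarzschild case `a = 0` "remains open" [cite: IonescuKlainerman2012, §1 (p. 3)]; (b) the printed theorem is at `𝓗⁻`; the `𝓗⁺` version rests on fn. 3 ("A similar statement can be made") and the `(t, φ) ↦ (−t, −φ)` symmetry, and "diffeomorphic to the unit ball" is dropped (existential weakening); (c) the would-be extension is required to be a smooth Killing field commuting with `T` and equal to `∂_φ` on `U ∩ {r ≤ r₊}` — non-existence of extensions NOT commuting with `T`, or of some other second Killing field of `g̃`, is not asserted (on a connected `U` the commutation clause is automatic: `[T, Z̃]` is a Killing field of `g̃` vanishing on the open Kerr side [folklore]); (d) Ricci-flatness and the Killing property are stated through the prelude's Levi-Civita-dependent API under the standing hypothesis `[g̃.HasLeviCivita]`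 bound inside (semantically neutral house idiom), and the identification of `∂_{t*}, ∂_φ` with the Kerr–Schild coordinate fields is that of `Kerr.stationaryField` / `Kerr.axialField`; (e) AUDIT 2026-08-15 — locality is the whole content: "The crucial point here is that the neighborhood under consideration is away from the bifurcate sphere, where [the local rigidity theorems] apply" [cite: IonescuKlainerman2015, §2.3]; nothing is asserted about neighbourhoods of a bifurcation sphere, where the Hawking and axial Killing fields exist without analyticity [cite: AlexakisIonescuKlainerman2010, Thms. 1.1–1.2], nor about stationary neighbourhoods of an entire horizon of constant non-zero surface gravity, where the Hawking field exists on both sides [cite: Lindbladpetersen2021, Thm. 1.17]; the formal localisation is `IonescuKlainermanNonExtension.small_ball`; (f) evasion (4) is a non-degenerate-horizon statement — unique continuation through compact null hypersurfaces fails at vanishing surface gravity [cite: Lindbladpetersen2021, Example 1.11]; (g) the obstruction the authors themselves regard as decisive for the GLOBAL problem is a different one, not formalised here: null geodesics trapped and perpendicular to a Killing field `T + cZ` defeat "a continuation argument starting form the horizon [...] Thus a full proof of the rigidity conjecture must rely on global properties of the space-time" (their conjecture: no trapped null geodesics perpendicular to `T` ⇒ Kerr) [cite: IonescuKlainerman2015,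 §4].
* status: established — theorem [cite: IonescuKlainerman2012, Thm. 1.3]; `blocks:` narrowed to the purely local step by the barrier audit of 2026-08-15 (module docstring, `evasions_known` (2)–(7)). -/
def IonescuKlainermanNonExtension : Prop :=
  ∀ (M a : ℝ), 0 < a → a < M →
    ∀ p : E4, Kerr.radius a p = Kerr.rPlus M a →
    ∀ U₀ : Set E4, IsOpen U₀ → p ∈ U₀ →
      ∃ (U : Opens E4) (g' : LorentzianMetric 𝓘(ℝ, E4) ∞ U),
        (U : Set E4) ⊆ U₀ ∧ ((U : Set E4) ∩ Kerr.futureEventHorizon M a).Nonempty ∧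
        (∀ x : U, Kerr.radius a (x : E4) ≤ Kerr.rPlus M a → g'.val x = Kerr.bilin M a (x : E4)) ∧
        ∀ [g'.HasLeviCivita],
          g'.toPseudoRiemannianMetric.IsRicciFlat ∧
          g'.toPseudoRiemannianMetric.IsKillingField (fun _ : U ↦ (E4.basisVector 0 : E4)) ∧
          ¬ ∃ Z : Π x : U, TangentSpace 𝓘(ℝ, E4) x,
              g'.toPseudoRiemannianMetric.IsKillingField Z ∧
              (∀ x : U, mfderiv 𝓘(ℝ, E4) 𝓘(ℝ, E4) (fun y : U ↦ (Z y : E4)) x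
                (E4.basisVector 0) = 0) ∧
              ∀ x : U, Kerr.radius a (x : E4) ≤ Kerr.rPlus M a →
                (Z x : E4) = (x.1 1) • E4.basisVector 2 - (x.1 2) • E4.basisVector 1

/-- The would-be extension in `IonescuKlainermanNonExtension` is prescribed on the black-hole
side by the axial field of the Kerr–Schild chart, `Kerr.axialField` (`∂_φ = x¹∂₂ − x²∂₁`): the
formula used in the fact is literally that of `Kerr.axialField a r₀` at points of the chart.
O'Neill 1995, Ch. 2, §2.2. [cite: ONeill1995, Ch. 2 §2.2] -/
theorem axialField_eq (a r₀ : ℝ) (x : Kerr.region a r₀) :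
    (Kerr.axialField a r₀ x : E4) = (x.1 1) • E4.basisVector 2 - (x.1 2) • E4.basisVector 1 :=
  rfl

/-- Likewise the stationary field prescribed in the fact is the chart's `Kerr.stationaryField`
(`∂_{t*}`, constant components `(1, 0, 0, 0)`). O'Neill 1995, Ch. 2, §2.2. [cite: ONeill1995, Ch. 2 §2.2] -/
theorem stationaryField_eq (a r₀ : ℝ) (x : Kerr.region a r₀) :
    (Kerr.stationaryField a r₀ x : E4) = E4.basisVector 0 :=
  rfl

/-- **Localisation of the barrier (audit 2026-08-15).** `IonescuKlainermanNonExtension` only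
ever speaks about metrics carried by open subsets of arbitrarily small balls around a horizon
point: specialising the open set `U₀` of the fact to `Metric.ball p ε` gives, for every `ε > 0`,
a modified metric on an open `U ⊆ B(p, ε)`. This is the whole formal content of the barrier —
nothing is asserted on neighbourhoods of a bifurcation sphere, where the Hawking and axial
Killing fields exist without analyticity [cite: AlexakisIonescuKlainerman2010, Thms. 1.1–1.2],
nor on stationary neighbourhoods of a whole horizon of constant non-zero surface gravity, where
the Hawking field exists on both sides [cite: Lindbladpetersen2021, Thm. 1.17]. Tautological
specialisation of the fact (house pattern of `stationary_black_hole_uniqueness.apply`).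
[cite: IonescuKlainerman2012, Thm. 1.3] -/
theorem IonescuKlainermanNonExtension.small_ball (h : IonescuKlainermanNonExtension)
    {M a : ℝ} (ha : 0 < a) (haM : a < M) {p : E4} (hp : Kerr.radius a p = Kerr.rPlus M a)
    {ε : ℝ} (hε : 0 < ε) :
    ∃ (U : Opens E4) (g' : LorentzianMetric 𝓘(ℝ, E4) ∞ U),
      (U : Set E4) ⊆ Metric.ball p ε ∧ ((U : Set E4) ∩ Kerr.futureEventHorizon M a).Nonempty ∧
      (∀ x : U, Kerr.radius a (x : E4) ≤ Kerr.rPlus M a → g'.val x = Kerr.bilin M a (x : E4)) ∧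
      ∀ [g'.HasLeviCivita],
        g'.toPseudoRiemannianMetric.IsRicciFlat ∧
        g'.toPseudoRiemannianMetric.IsKillingField (fun _ : U ↦ (E4.basisVector 0 : E4)) ∧
        ¬ ∃ Z : Π x : U, TangentSpace 𝓘(ℝ, E4) x,
            g'.toPseudoRiemannianMetric.IsKillingField Z ∧
            (∀ x : U, mfderiv 𝓘(ℝ, E4) 𝓘(ℝ, E4) (fun y : U ↦ (Z y : E4)) x
              (E4.basisVector 0) = 0) ∧
            ∀ x : U, Kerr.radius a (x : E4) ≤ Kerr.rPlus M a →
              (Z x : E4) = (x.1 1) • E4.basisVector 2 - (x.1 2) • E4.basisVector 1 :=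
  h M a ha haM p hp (Metric.ball p ε) Metric.isOpen_ball (Metric.mem_ball_self hε)

end Literature.Barriers.FinalStateConjecture

end
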